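import Literature.Analysis.FluidPDE.NSSerrinUniqueness
import HarnessLib

/-!
# Weak–strong uniqueness (ns.S07): discharge of `weak_strong_uniqueness` for all data

Analysis/FluidPDE file closing the discharge programme of the named fact
`Literature.Analysis.FluidPDE.weak_strong_uniqueness` (**ns.S07**; Prodi 1959; Serrin 1963, Thm. 6;
Robinson–Rodrigo–Sadowski 2016, Thm. 8.19): a Leray–Hopf weak solution `u` of the unforced
Navier–Stokes system on `ℝ³ × [0,T)` in a Serrin class `L^q(0,T;L^r)`, `2/q + 3/r ≤ 1`,
`3 < r ≤ ∞`, is unique among the Leray–Hopf weak solutions with the same datum `u₀` (slices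
compared on `(0,T]`).

**What was already proved.** The sources assume `u₀ ∈ H = L²_σ(ℝ³)` (RRS 2016, Def. 3.3;
Serrin 1963, §1), while the accepted fact quantifies over *all* `u₀ : ℝ³ → ℝ³`; the accepted
`Fluid.IsLerayHopfOn` sees `u₀` only through Bochner pairings `∫ ⟪u₀, ·⟫`, the Bochner energy
`kineticEnergy u₀` and the lower integral `eLpNorm (u t - u₀) 2 → 0`. The printed theorem is the
accepted `serrin_weak_strong_uniqueness_holds` (`NSSerrinUniqueness`, datum in `L²`), and the
accepted `weak_strong_uniqueness_of_datum` covers a.e. strongly measurable data (which are then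
`L²`) and data with `‖u₀‖²` non-integrable (then `kineticEnergy u₀ = 0` kills both solutions).

**What is proved here.** The remaining data are handled by the dichotomy
`IsLerayHopfOn.aestronglyMeasurable_datum_or`: if `u₀` is not a.e. strongly measurable then its
datum functional vanishes on `L²`, `∫ ⟪u₀, w⟫ = 0` for every `w ∈ L²` (the solutions have weak
`L²`-trace `0` at `t → 0⁺`). The main lemma of this file
(`IsLerayHopfOn.kineticEnergy_eq_zero_of_datum_functional_eq_zero`) shows that a Leray–Hopf
solution **in a Serrin class** with null datum functional vanishes: `u(t) = 0` a.e. for every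
`t ∈ (0,T]`. Its proof tests the weak formulation at a good time `t₀` with the `H¹_σ` field
`Ψ = u(t₀)` itself (the `H¹_σ` time-slice identity, here re-proved without any hypothesis on the
datum, `IsLerayHopfOn.inner_weakGrad_test_eq'`):
`‖u(t₀)‖₂² = ∫₀^{t₀} ( ∫ ⟪∇u(t₀) u, u⟫ - ν ⟨∇u, ∇u(t₀)⟩ ) ds`,
bounds the trilinear term by `‖∇u(t₀)‖₂ ‖u(s)‖_p ‖u(s)‖_r`, `1/p + 1/r = 1/2`, with the
Sobolev–interpolation bound `‖u(s)‖_p ≤ ‖u(s)‖₂^{1-θ} (K‖∇u(s)‖₂)^θ`, `θ = 3/r`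
(RRS 2016, proof of Lemma 8.18), and then uses Cauchy–Schwarz and the concave-power Jensen
inequality in time to get
`‖u(t₀)‖₂² ≤ (t₀ ‖∇u(t₀)‖₂²)^{1/2} · (C₁ ε(t₀)^{θ/2} α(t₀)^{(1-θ)/2} + C₂ ε(t₀)^{1/2})`,
`ε(t) = ∫₀ᵗ‖∇u‖₂²`, `α(t) = ∫₀ᵗ ‖u‖_r^{2/(1-θ)}`; good times `t₀ → 0⁺` with `t₀‖∇u(t₀)‖₂² ≤ 1`
exist because `∫₀ᵀ ‖∇u‖₂² < ∞`, and the energy is non-increasing (energy inequality from a.e.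
`s`), so `‖u(t)‖₂ = 0` for every `t > 0`. With `u ≡ 0` on `(0,T]`, the strong-attainment clause
`eLpNorm (u t - u₀) 2 → 0` forces `∫⁻ ‖u₀‖ₑ² = 0`; when `‖u₀‖²` is integrable this gives
`u₀ = 0` a.e., i.e. `u₀` *is* a.e. strongly measurable, and `weak_strong_uniqueness_of_datum`
finishes. Hence `weak_strong_uniqueness_holds : weak_strong_uniqueness` with no change to the
accepted statement. (The junk branch is not in the sources; the argument above is elementary and
self-contained, and is recorded as `[folklore]` glue around the cited theorem.)

## Contents

* `lintegral_rpow_le_mul_lintegral_rpow`, `setLIntegral_Ioo_rpow_le` — concave-power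
  Jensen/Hölder: `∫ f^γ ≤ μ(univ)^{1-γ} (∫ f)^γ`, `0 ≤ γ ≤ 1`.
* `IsLerayHopfOn.inner_weakGrad_test_eq'` — the `H¹_σ` slice identity for every Leray–Hopf
  solution, no datum hypothesis.
* `enorm_weakFlux_le_of_hasWeakGradient`, `setLIntegral_rpow_mul_le`,
  `setLIntegral_rpow_half_le` — the slice bound of the `H¹_σ` flux and its time integration.
* `IsLerayHopfOn.kineticEnergy_eq_zero_of_datum_functional_eq_zero` — vanishing of Serrin-class
  Leray–Hopf solutions with null datum functional.
* `weak_strong_uniqueness_holds`.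

## Mathlib / tree search

Mathlib has Hölder for lower integrals (`ENNReal.lintegral_mul_le_Lp_mul_Lq`) but no ready-made
concave-power Jensen bound for `∫ f^γ` (searched `lintegral_rpow_le`, `rpow_lintegral_le`); the
tree supplies all Navier–Stokes ingredients (`LerayHopfH1Test`, `NSSerrinEstimates`,
`NSSerrinUniqueness`, `LerayHopfProofs`), reused verbatim. No definitions are introduced.

## References

* G. Prodi, *Un teorema di unicità per le equazioni di Navier–Stokes*, Ann. Mat. Pura Appl. 48
  (1959), 173–182 (`Prodi1959`).
* J. Serrin, *The initial value problem for the Navier–Stokes equations*, in: Nonlinear Problems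
  (Madison 1962), Univ. Wisconsin Press 1963, §4, Thm. 6 (`Serrin1963`).
* J. C. Robinson, J. L. Rodrigo, W. Sadowski, *The Three-Dimensional Navier–Stokes Equations*,
  CUP 2016, Def. 3.3, Lemma 8.18, Thm. 8.19 (`RobinsonRodrigoSadowski2016`).
* G. P. Galdi, *An introduction to the Navier–Stokes initial–boundary value problem*, Birkhäuser
  2000, Lemma 2.1, Def. 2.1 (`Galdi2000`).
-/

noncomputable section

open MeasureTheory TopologicalSpace Set Function Filter Topology ContinuousLinearMap Module
open scoped ENNReal NNReal InnerProductSpace RealInnerProductSpace Laplacian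

namespace Literature.Analysis.FluidPDE

/-! ### Concave-power Jensen inequality in time -/

section Jensen

/-- **Concave-power Jensen / Hölder inequality**: for `0 ≤ γ ≤ 1` and an a.e.-measurable
`f : α → [0, ∞]`, `∫ f^γ dμ ≤ μ(univ)^{1-γ} (∫ f dμ)^γ` (Hölder with the exponents `1/γ`,
`1/(1-γ)` applied to `f^γ · 1`; the cases `γ = 0, 1` are identities). [folklore] -/
theorem lintegral_rpow_le_mul_lintegral_rpow {α : Type*} [MeasurableSpace α] (μ : Measure α)
    {f : α → ℝ≥0∞} (hf : AEMeasurable f μ) {γ : ℝ} (hγ0 : 0 ≤ γ) (hγ1 : γ ≤ 1) :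
    ∫⁻ a, f a ^ γ ∂μ ≤ μ univ ^ (1 - γ) * (∫⁻ a, f a ∂μ) ^ γ := by
  rcases hγ0.eq_or_lt with rfl | hγ0'
  · simp only [ENNReal.rpow_zero, lintegral_const, one_mul, sub_zero, ENNReal.rpow_one, mul_one,
      le_refl]
  rcases hγ1.lt_or_eq with hγ1' | rfl
  · have hpq : (1 / γ).HolderConjugate (1 / (1 - γ)) :=
      Real.holderConjugate_one_div hγ0' (by linarith) (by ring)
    have h := ENNReal.lintegral_mul_le_Lp_mul_Lq μ hpq (hf.pow_const γ) aemeasurable_const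
      (g := fun _ => (1 : ℝ≥0∞))
    have hfg : (fun a => f a ^ γ) * (fun _ => (1 : ℝ≥0∞)) = fun a => f a ^ γ := by
      funext a; simp
    rw [hfg] at h
    refine h.trans (le_of_eq ?_)
    have h1 : ∫⁻ a, (f a ^ γ) ^ (1 / γ) ∂μ = ∫⁻ a, f a ∂μ := by
      refine lintegral_congr fun a => ?_
      rw [← ENNReal.rpow_mul, mul_one_div_cancel hγ0'.ne', ENNReal.rpow_one]
    rw [h1]
    simp only [ENNReal.one_rpow, lintegral_const, one_mul, one_div, inv_inv]
    rw [mul_comm]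
  · simp only [ENNReal.rpow_one, sub_self, ENNReal.rpow_zero, one_mul, le_refl]

/-- The set version on a real interval: for `0 ≤ γ ≤ 1` and `f` a.e.-measurable on
`(a, b)`, `∫_{(a,b)} f^γ ≤ (b - a)^{1-γ} (∫_{(a,b)} f)^γ` (for `b < a` both sides concern the empty
interval and `ofReal (b - a) = 0`). [folklore] -/
theorem setLIntegral_Ioo_rpow_le {f : ℝ → ℝ≥0∞} {a b : ℝ}
    (hf : AEMeasurable f (volume.restrict (Ioo a b))) {γ : ℝ} (hγ0 : 0 ≤ γ) (hγ1 : γ ≤ 1) :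
    ∫⁻ s in Ioo a b, f s ^ γ ≤ ENNReal.ofReal (b - a) ^ (1 - γ) * (∫⁻ s in Ioo a b, f s) ^ γ := by
  have h := lintegral_rpow_le_mul_lintegral_rpow (volume.restrict (Ioo a b)) hf hγ0 hγ1
  rwa [Measure.restrict_apply_univ, Real.volume_Ioo] at h

end Jensen

variable {E : Type*} [NormedAddCommGroup E] [InnerProductSpace ℝ E] [FiniteDimensional ℝ E]
  [MeasurableSpace E] [BorelSpace E]

/-! ### The `H¹_σ` time-slice identity without a datum hypothesis -/

section H1Test

variable {T ν : ℝ} {u₀ : E → E} {u : ℝ → E → E}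

/-- **The `H¹_σ` time-slice identity for every Leray–Hopf solution** (Galdi 2000, Lemma 2.1 with
(2.8)/(4.3); Serrin 1963, (6); Robinson–Rodrigo–Sadowski 2016, Lemma 8.18, density step). Let
`dim E = 3`, `u` a Leray–Hopf weak solution of the unforced Navier–Stokes system on `E × [0,T)`,
`T > 0`, with datum `u₀` (any function), `Gu` a jointly measurable weak-gradient witness of `u`
(a.e. in time) with `∫₀ᵀ ∫|Gu|² < ∞`, and `Ψ ∈ L²` weakly divergence free with weak gradient `GΨ`,
`∫|GΨ|² < ∞`. Then for every `t ∈ (0, T]`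
`⟨u(t), Ψ⟩ = ∫ ⟪u₀, Ψ⟫ + ∫_{(0,t]} ( ∫ ⟪GΨ u, u⟫ - ν Σᵢ ∫ ⟪Gu eᵢ, GΨ eᵢ⟫ ) ds`.
This is the accepted `IsLerayHopfOn.inner_weakGrad_test_eq` with its hypothesis `u₀ ∈ L²`
removed by the dichotomy `IsLerayHopfOn.aestronglyMeasurable_datum_or`: either `u₀` is a.e.
strongly measurable, hence in `L²` (`IsLerayHopfOn.memLp_two_datum`), or every datum pairing
`∫ ⟪u₀, w⟫`, `w ∈ L²`, vanishes, in which case the density argument of the accepted proof goes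
through with all datum terms equal to `0`. [cite: Galdi2000, Lemma 2.1] -/
theorem IsLerayHopfOn.inner_weakGrad_test_eq' (hE3 : finrank ℝ E = 3)
    (hu : IsLerayHopfOn T ν 0 u₀ u) (hT : 0 < T)
    {Gu : ℝ → E → E →L[ℝ] E}
    (hGum : StronglyMeasurable (uncurry Gu))
    (hGu : ∀ᵐ t ∂(volume.restrict (Ioo 0 T)), HasWeakGradient (u t) (Gu t))
    (hGu₂ : ∫⁻ t in Ioo 0 T, ∫⁻ x, ENNReal.ofReal (frobeniusNormSq (Gu t x)) < ⊤)
    {Ψ : E → E} {GΨ : E → E →L[ℝ] E} (hΨ2 : MemLp Ψ 2 volume) (hΨdiv : IsWeaklyDivFree Ψ)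
    (hΨG : HasWeakGradient Ψ GΨ) (hGΨ2 : ∫⁻ x, ENNReal.ofReal (frobeniusNormSq (GΨ x)) < ⊤)
    {t : ℝ} (ht : t ∈ Ioc 0 T) :
    ∫ x, ⟪u t x, Ψ x⟫ = (∫ x, ⟪u₀ x, Ψ x⟫) +
      ∫ s in Ioc 0 t, ((∫ x, ⟪GΨ x (u s x), u s x⟫) -
        ν * ∑ i, ∫ x, ⟪Gu s x (stdOrthonormalBasis ℝ E i), GΨ x (stdOrthonormalBasis ℝ E i)⟫) := by
  rcases hu.aestronglyMeasurable_datum_or hT with hm | h0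
  · exact hu.inner_weakGrad_test_eq hE3 (hu.memLp_two_datum hT hm) hT hGum hGu hGu₂ hΨ2 hΨdiv
      hΨG hGΨ2 ht
  -- ### degenerate branch: all datum pairings vanish
  set b := stdOrthonormalBasis ℝ E with hb
  haveI : ENNReal.HolderTriple 4 4 2 := holderTriple_four_four_two
  have hGΨm : AEStronglyMeasurable GΨ volume := hΨG.aestronglyMeasurable_deriv
  -- the approximating test fields
  set δ : ℕ → ℝ≥0∞ := fun n => ((n + 1 : ℕ) : ℝ≥0∞)⁻¹ with hδdef
  have hδpos : ∀ n, 0 < δ n := fun n => ENNReal.inv_pos.2 (ENNReal.natCast_ne_top _)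
  have hδlim : Tendsto δ atTop (𝓝 0) :=
    ENNReal.tendsto_inv_nat_nhds_zero.comp (tendsto_add_atTop_nat 1)
  have hδlim' : Tendsto (fun n => δ n ^ (1 / 2 : ℝ)) atTop (𝓝 0) := by
    have := ((ENNReal.continuous_rpow_const (y := 1 / 2)).tendsto (0 : ℝ≥0∞)).comp hδlim
    rwa [ENNReal.zero_rpow_of_pos (by norm_num)] at this
  choose Φ hΦtest hΦdiv hΦL2 hΦH1 using fun n : ℕ =>
    exists_isDivFree_test_approx hE3 hΨ2 hΨdiv hΨG hGΨ2 (hδpos n)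
  have hΦD : ∀ n, AEStronglyMeasurable (fderiv ℝ (Φ n)) volume := fun n =>
    ((hΦtest n).contDiff.continuous_fderiv (by simp)).aestronglyMeasurable
  have hΦDfin : ∀ n, ∫⁻ x, ENNReal.ofReal (frobeniusNormSq (fderiv ℝ (Φ n) x)) < ⊤ := by
    intro n
    have hc : Continuous (frobeniusNormSq ∘ fderiv ℝ (Φ n)) :=
      NSWeakStrongUniqueness.continuous_frobeniusNormSq.comp
        ((hΦtest n).contDiff.continuous_fderiv (by simp))
    have hK : HasCompactSupport (frobeniusNormSq ∘ fderiv ℝ (Φ n)) :=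
      ((hΦtest n).hasCompactSupport.fderiv ℝ).comp_left frobeniusNormSq_zero
    have hi : Integrable (frobeniusNormSq ∘ fderiv ℝ (Φ n)) volume :=
      hc.integrable_of_hasCompactSupport hK
    have h2 : ∫⁻ x, ‖(frobeniusNormSq ∘ fderiv ℝ (Φ n)) x‖ₑ < ⊤ := hi.2
    refine lt_of_le_of_lt (lintegral_mono fun x => ?_) h2
    exact Real.ofReal_le_enorm _
  -- notation: fluxes and the weight
  set FΦ : ℕ → ℝ → ℝ := fun n s =>
    ∫ x, (⟪u s x, convect (u s) (Φ n) x⟫ + ν * ⟪u s x, (Δ (Φ n)) x⟫) with hFΦ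
  set F : ℝ → ℝ := fun s => (∫ x, ⟪GΨ x (u s x), u s x⟫) -
    ν * ∑ i, ∫ x, ⟪Gu s x (b i), GΨ x (b i)⟫ with hF
  set W : ℝ → ℝ≥0∞ := fun s => eLpNorm (u s) 4 volume ^ (2 : ℝ) + ENNReal.ofReal |ν| *
    ∑ i, eLpNorm (fun x => Gu s x (b i)) 2 volume with hW
  have hIW : ∫⁻ s, W s ∂(volume.restrict (Ioo 0 T)) < ⊤ :=
    hu.lintegral_weight_lt_top hE3 hGum hGu hGu₂
  -- the identities for the test fields, with vanishing datum term
  have hI : ∀ n, ∫ x, ⟪u t x, Φ n x⟫ = 0 + ∫ s in Ioc 0 t, FΦ n s := fun n => by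
    have h := hu.inner_test_eq hT (hΦtest n) (hΦdiv n) ht
    rw [h0 (Φ n) ((hΦtest n).memLp_volume 2)] at h
    simpa only [hFΦ] using h
  -- the pointwise error bound for a.e. `s`
  set D : ℝ → ℝ≥0∞ := fun s => ∫⁻ x, ENNReal.ofReal (frobeniusNormSq (Gu s x)) with hD
  have hDm : Measurable D := measurable_lintegral_frobeniusNormSq hGum
  have hDfin : ∀ᵐ s ∂(volume.restrict (Ioo 0 T)), D s < ⊤ := ae_lt_top hDm hGu₂.ne
  have h4fin : ∀ᵐ s ∂(volume.restrict (Ioo 0 T)), eLpNorm (u s) 4 volume < ⊤ := by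
    have h := ae_lt_top'
      ((FunctionSpaces.aemeasurable_eLpNorm_slice hu.aestronglyMeasurable_uncurry 4).pow_const
        (2 : ℝ)) (hu.lintegral_eLpNorm_four_sq_lt_top hE3 hGum hGu hGu₂).ne
    filter_upwards [h] with s hs
    exact (ENNReal.rpow_lt_top_iff_of_pos zero_lt_two).1 hs
  have hgood : ∀ᵐ s ∂(volume.restrict (Ioo 0 T)), ∀ n,
      ‖FΦ n s - F s‖ₑ ≤ δ n ^ (1 / 2 : ℝ) * W s := by
    filter_upwards [hGu, ae_restrict_mem measurableSet_Ioo, hDfin, h4fin] with s hGs hsI hDs h4s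
    intro n
    have hmem2 : MemLp (u s) 2 volume := hu.memLp s (Ioo_subset_Icc_self hsI)
    have hmem4 : MemLp (u s) 4 volume := ⟨hmem2.1, h4s⟩
    have i1 : Integrable (fun x => ⟪u s x, convect (u s) (Φ n) x⟫) volume :=
      integrable_inner_fderiv_apply_of_memLp_two hmem2 hmem2 (hΦtest n)
    have i2 : Integrable (fun x => ⟪u s x, (Δ (Φ n)) x⟫) volume :=
      integrable_inner_of_memLp_two hmem2 ((hΦtest n).memLp_laplacian 2)
    have hflux : FΦ n s = (∫ x, ⟪fderiv ℝ (Φ n) x (u s x), u s x⟫) -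
        ν * ∑ i, ∫ x, ⟪Gu s x (b i), fderiv ℝ (Φ n) x (b i)⟫ := by
      simp only [hFΦ]
      rw [integral_add i1 (i2.const_mul ν), MeasureTheory.integral_const_mul,
        hGs.integral_inner_laplacian_test (hΦtest n)]
      have : ∫ x, ⟪u s x, convect (u s) (Φ n) x⟫ = ∫ x, ⟪fderiv ℝ (Φ n) x (u s x), u s x⟫ :=
        integral_congr_ae (ae_of_all _ fun x => by
          dsimp only; rw [convect_apply, real_inner_comm])
      rw [this]; ring
    rw [hflux]
    have hGi : ∀ i, MemLp (fun x => Gu s x (b i)) 2 volume := fun i => hGs.memLp_apply hDs i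
    refine (enorm_weakFlux_sub_le hmem4 hGs.aestronglyMeasurable_deriv hGi (hΦD n) hGΨm
      (hΦDfin n) hGΨ2 ν).trans ?_
    exact mul_le_mul' (ENNReal.rpow_le_rpow (hΦH1 n) (by norm_num)) le_rfl
  -- integrability of the fluxes on `(0, T)` and on `(0, t]`
  have hWm : AEMeasurable W (volume.restrict (Ioo 0 T)) := by
    refine ((FunctionSpaces.aemeasurable_eLpNorm_slice hu.aestronglyMeasurable_uncurry 4).pow_const
      _).add (AEMeasurable.const_mul (Finset.aemeasurable_fun_sum _ fun i _ => ?_) _)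
    exact (FunctionSpaces.measurable_eLpNorm_slice (g := fun s x => Gu s x (b i))
      ((ContinuousLinearMap.apply ℝ E (b i)).continuous.comp_stronglyMeasurable hGum)
        2).aemeasurable
  have hFΦint : ∀ n, IntegrableOn (FΦ n) (Ioo 0 T) := fun n => by
    rw [hFΦ]; exact hu.integrableOn_flux (hΦtest n)
  have hFint : IntegrableOn F (Ioo 0 T) :=
    hu.integrableOn_weakFlux hE3 hGum hGu hGu₂ hGΨm hGΨ2
  have hsub : Ioo 0 t ⊆ Ioo 0 T := Ioo_subset_Ioo le_rfl ht.2
  have hFΦt : ∀ n, IntegrableOn (FΦ n) (Ioc 0 t) := fun n =>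
    (integrableOn_Ioc_iff_integrableOn_Ioo (hb := enorm_ne_top)).2 ((hFΦint n).mono_set hsub)
  have hFt : IntegrableOn F (Ioc 0 t) :=
    (integrableOn_Ioc_iff_integrableOn_Ioo (hb := enorm_ne_top)).2 (hFint.mono_set hsub)
  -- limit of the flux integrals
  have hflux_lim : Tendsto (fun n => ∫ s in Ioc 0 t, FΦ n s) atTop (𝓝 (∫ s in Ioc 0 t, F s)) := by
    refine tendsto_of_enorm_sub_le
      (e := fun n => δ n ^ (1 / 2 : ℝ) * ∫⁻ s, W s ∂(volume.restrict (Ioo 0 T))) (fun n => ?_) ?_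
    · rw [← integral_sub (hFΦt n) hFt]
      calc ‖∫ s in Ioc 0 t, (FΦ n s - F s)‖ₑ ≤ ∫⁻ s in Ioc 0 t, ‖FΦ n s - F s‖ₑ :=
            enorm_integral_le_lintegral_enorm _
        _ = ∫⁻ s in Ioo 0 t, ‖FΦ n s - F s‖ₑ := setLIntegral_congr Ioo_ae_eq_Ioc.symm
        _ ≤ ∫⁻ s in Ioo 0 T, ‖FΦ n s - F s‖ₑ := lintegral_mono_set hsub
        _ ≤ ∫⁻ s in Ioo 0 T, δ n ^ (1 / 2 : ℝ) * W s :=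
            lintegral_mono_ae (hgood.mono fun s hs => hs n)
        _ = δ n ^ (1 / 2 : ℝ) * ∫⁻ s, W s ∂(volume.restrict (Ioo 0 T)) :=
            lintegral_const_mul'' _ hWm
    · have h := ENNReal.Tendsto.mul_const hδlim' (Or.inr hIW.ne)
      rwa [zero_mul] at h
  -- limit of the pairings with the slice `u t ∈ L²`
  have hut : MemLp (u t) 2 volume := hu.memLp t ⟨ht.1.le, ht.2⟩
  have hL : Tendsto (fun n => ∫ x, ⟪u t x, Φ n x⟫) atTop (𝓝 (∫ x, ⟪u t x, Ψ x⟫)) := by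
    refine tendsto_of_enorm_sub_le (e := fun n => eLpNorm (u t) 2 volume * δ n) (fun n => ?_) ?_
    · rw [← integral_sub (integrable_inner_of_memLp_two hut ((hΦtest n).memLp_volume 2))
        (integrable_inner_of_memLp_two hut hΨ2)]
      have : (fun x => ⟪u t x, Φ n x⟫ - ⟪u t x, Ψ x⟫) = fun x => ⟪u t x, (Φ n - Ψ) x⟫ := by
        ext x; rw [Pi.sub_apply, inner_sub_right]
      rw [this]
      exact (FunctionSpaces.enorm_integral_inner_le_eLpNorm_mul hut.1
        (((hΦtest n).memLp_volume 2).sub hΨ2).1).trans (mul_le_mul' le_rfl (hΦL2 n))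
    · have h := ENNReal.Tendsto.const_mul hδlim (Or.inr hut.eLpNorm_ne_top)
      rwa [mul_zero] at h
  have hR : Tendsto (fun n => (0 : ℝ) + ∫ s in Ioc 0 t, FΦ n s) atTop
      (𝓝 (0 + ∫ s in Ioc 0 t, F s)) := tendsto_const_nhds.add hflux_lim
  have hLR : (fun n => ∫ x, ⟪u t x, Φ n x⟫) = fun n => (0 : ℝ) + ∫ s in Ioc 0 t, FΦ n s :=
    funext hI
  rw [hLR] at hL
  rw [h0 Ψ hΨ2]
  exact tendsto_nhds_unique hL hR

end H1Test

/-! ### Slice estimates for the vanishing lemma -/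

section SliceEstimates

/-- **Pointwise bound of the `H¹_σ` flux against a gradient density** (three-factor Hölder with
the conjugate Serrin exponent `1/p + 1/r = 1/2` and the Sobolev–interpolation bound
`‖w‖_p ≤ ‖w‖₂^{1-θ} (K‖∇w‖₂)^θ`, `θ = 3/r`, Robinson–Rodrigo–Sadowski 2016, proof of Lemma 8.18;
Cauchy–Schwarz for the viscous part). In dimension `3`, for `3 < r`, `w ∈ L²` with weak gradient
`Gw` and a gradient density `A`:
`|∫⟪A w, w⟫ - ν Σᵢ ∫⟪Gw eᵢ, A eᵢ⟫| ≤ ‖A‖₂ (‖w‖₂^{1-θ} (K ‖Gw‖₂)^θ ‖w‖_r + |ν| dim E ‖Gw‖₂)`.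
[cite: RobinsonRodrigoSadowski2016, proof of Lemma 8.18] -/
theorem enorm_weakFlux_le_of_hasWeakGradient (hE3 : finrank ℝ E = 3) {r : ℝ≥0∞} (hr : 3 < r)
    {w : E → E} {Gw A : E → E →L[ℝ] E} (hw2 : MemLp w 2 volume) (hwG : HasWeakGradient w Gw)
    (hA : AEStronglyMeasurable A volume) (ν : ℝ) :
    ‖(∫ x, ⟪A x (w x), w x⟫) -
        ν * ∑ i, ∫ x, ⟪Gw x (stdOrthonormalBasis ℝ E i), A x (stdOrthonormalBasis ℝ E i)⟫‖ₑ ≤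
      (∫⁻ x, ENNReal.ofReal (frobeniusNormSq (A x))) ^ (1 / 2 : ℝ) *
        (eLpNorm w 2 volume ^ (1 - ((3 : ℝ≥0∞) / r).toReal) *
            ((SNormLESNormFDerivOfEqConst E (volume : Measure E) 2 : ℝ≥0∞) *
              (∫⁻ x, ENNReal.ofReal (frobeniusNormSq (Gw x))) ^ (1 / 2 : ℝ)) ^
                ((3 : ℝ≥0∞) / r).toReal *
            eLpNorm w r volume +
          ENNReal.ofReal |ν| * (finrank ℝ E : ℝ≥0∞) *
            (∫⁻ x, ENNReal.ofReal (frobeniusNormSq (Gw x))) ^ (1 / 2 : ℝ)) := by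
  set b := stdOrthonormalBasis ℝ E with hb
  have hb1 : ∀ i, ‖b i‖ = 1 := fun i => b.orthonormal.1 i
  haveI := holderTriple_conj_two (r := r) (le_trans (by norm_num) hr.le)
  set DA : ℝ≥0∞ := ∫⁻ x, ENNReal.ofReal (frobeniusNormSq (A x)) with hDA
  set Dw : ℝ≥0∞ := ∫⁻ x, ENNReal.ofReal (frobeniusNormSq (Gw x)) with hDw
  set θ : ℝ := ((3 : ℝ≥0∞) / r).toReal with hθ
  set Cs : ℝ≥0∞ := (SNormLESNormFDerivOfEqConst E (volume : Measure E) 2 : ℝ≥0∞) with hCs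
  have hGwm : AEStronglyMeasurable Gw volume := hwG.aestronglyMeasurable_deriv
  -- the trilinear part
  have h1 : ‖∫ x, ⟪A x (w x), w x⟫‖ₑ ≤
      DA ^ (1 / 2 : ℝ) * (eLpNorm w ((2⁻¹ - r⁻¹)⁻¹) volume * eLpNorm w r volume) :=
    (enorm_integral_le_lintegral_enorm _).trans (lintegral_enorm_inner_apply_le hA hw2.1 hw2.1 _ _)
  have h2 : eLpNorm w ((2⁻¹ - r⁻¹)⁻¹) volume ≤
      eLpNorm w 2 volume ^ (1 - θ) * (Cs * Dw ^ (1 / 2 : ℝ)) ^ θ :=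
    eLpNorm_conj_le_of_hasWeakGradient hE3 hr hw2 hwG
  -- the viscous part
  have h3 : ∀ i, ‖∫ x, ⟪Gw x (b i), A x (b i)⟫‖ₑ ≤ Dw ^ (1 / 2 : ℝ) * DA ^ (1 / 2 : ℝ) := fun i =>
    (enorm_integral_inner_apply_apply_le Gw A hGwm hA (b i) (hb1 i)).trans
      (mul_le_mul' (eLpNorm_apply_le_lintegral_frobenius_rpow Gw (b i) (hb1 i)) le_rfl)
  have h4 : ‖ν * ∑ i, ∫ x, ⟪Gw x (b i), A x (b i)⟫‖ₑ ≤
      ENNReal.ofReal |ν| * ((finrank ℝ E : ℝ≥0∞) * (Dw ^ (1 / 2 : ℝ) * DA ^ (1 / 2 : ℝ))) := by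
    rw [enorm_mul, Real.enorm_eq_ofReal_abs]
    gcongr
    calc ‖∑ i, ∫ x, ⟪Gw x (b i), A x (b i)⟫‖ₑ ≤ ∑ i, ‖∫ x, ⟪Gw x (b i), A x (b i)⟫‖ₑ :=
          enorm_sum_le _ _
      _ ≤ ∑ _i : Fin (finrank ℝ E), Dw ^ (1 / 2 : ℝ) * DA ^ (1 / 2 : ℝ) :=
          Finset.sum_le_sum fun i _ => h3 i
      _ = (finrank ℝ E : ℝ≥0∞) * (Dw ^ (1 / 2 : ℝ) * DA ^ (1 / 2 : ℝ)) := by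
          rw [Finset.sum_const, Finset.card_univ, Fintype.card_fin, nsmul_eq_mul]
  calc ‖(∫ x, ⟪A x (w x), w x⟫) - ν * ∑ i, ∫ x, ⟪Gw x (b i), A x (b i)⟫‖ₑ
      ≤ ‖∫ x, ⟪A x (w x), w x⟫‖ₑ + ‖ν * ∑ i, ∫ x, ⟪Gw x (b i), A x (b i)⟫‖ₑ := enorm_sub_le
    _ ≤ DA ^ (1 / 2 : ℝ) * (eLpNorm w 2 volume ^ (1 - θ) * (Cs * Dw ^ (1 / 2 : ℝ)) ^ θ *
          eLpNorm w r volume) +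
        ENNReal.ofReal |ν| * ((finrank ℝ E : ℝ≥0∞) * (Dw ^ (1 / 2 : ℝ) * DA ^ (1 / 2 : ℝ))) := by
        gcongr ?_ + ?_
        exact h1.trans (by gcongr)
    _ = _ := by ring

/-- **Time integration of the slice bounds** (Cauchy–Schwarz and concave-power Jensen in time).
For `0 ≤ θ < 1`, `ρ = 2/(1-θ)`, a measurable `D ≥ 0` and an a.e.-measurable `N ≥ 0` on `(0, t₀)`:
`∫₀^{t₀} D^{θ/2} N ≤ t₀^{1/2} (∫₀^{t₀} D)^{θ/2} (∫₀^{t₀} N^ρ)^{(1-θ)/2}`. [folklore] -/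
theorem setLIntegral_rpow_mul_le {D N : ℝ → ℝ≥0∞} {t₀ : ℝ}
    (hD : AEMeasurable D (volume.restrict (Ioo 0 t₀)))
    (hN : AEMeasurable N (volume.restrict (Ioo 0 t₀))) {θ : ℝ} (hθ0 : 0 ≤ θ) (hθ1 : θ < 1) :
    ∫⁻ s in Ioo 0 t₀, D s ^ (θ / 2) * N s ≤
      ENNReal.ofReal t₀ ^ (1 / 2 : ℝ) * ((∫⁻ s in Ioo 0 t₀, D s) ^ (θ / 2) *
        (∫⁻ s in Ioo 0 t₀, N s ^ (2 / (1 - θ))) ^ ((1 - θ) / 2)) := by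
  set ρ : ℝ := 2 / (1 - θ) with hρ
  have h1θ : 0 < 1 - θ := by linarith
  have hρθ : ρ * (1 - θ) = 2 := by rw [hρ]; field_simp
  have h22 : (2 : ℝ).HolderConjugate 2 := Real.holderConjugate_iff.2 ⟨one_lt_two, by norm_num⟩
  -- Cauchy–Schwarz in time
  have hCS := ENNReal.lintegral_mul_le_Lp_mul_Lq (volume.restrict (Ioo 0 t₀)) h22
    (hD.pow_const (θ / 2)) hN
  have hDθ : ∫⁻ s in Ioo 0 t₀, (D s ^ (θ / 2)) ^ (2 : ℝ) = ∫⁻ s in Ioo 0 t₀, D s ^ θ := by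
    refine lintegral_congr fun s => ?_
    rw [← ENNReal.rpow_mul]; congr 1; ring
  have hN2 : ∫⁻ s in Ioo 0 t₀, N s ^ (2 : ℝ) = ∫⁻ s in Ioo 0 t₀, (N s ^ ρ) ^ (1 - θ) := by
    refine lintegral_congr fun s => ?_
    rw [← ENNReal.rpow_mul, hρθ]
  -- Jensen in time for the two factors
  have hJ1 : ∫⁻ s in Ioo 0 t₀, D s ^ θ ≤
      ENNReal.ofReal t₀ ^ (1 - θ) * (∫⁻ s in Ioo 0 t₀, D s) ^ θ := by
    simpa only [sub_zero] using setLIntegral_Ioo_rpow_le hD hθ0 hθ1.le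
  have hJ2 : ∫⁻ s in Ioo 0 t₀, (N s ^ ρ) ^ (1 - θ) ≤
      ENNReal.ofReal t₀ ^ θ * (∫⁻ s in Ioo 0 t₀, N s ^ ρ) ^ (1 - θ) := by
    have h := setLIntegral_Ioo_rpow_le (hN.pow_const ρ) h1θ.le (by linarith : 1 - θ ≤ 1)
    simpa only [sub_zero, sub_sub_cancel] using h
  calc ∫⁻ s in Ioo 0 t₀, D s ^ (θ / 2) * N s
      ≤ (∫⁻ s in Ioo 0 t₀, (D s ^ (θ / 2)) ^ (2 : ℝ)) ^ (1 / (2 : ℝ)) *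
          (∫⁻ s in Ioo 0 t₀, N s ^ (2 : ℝ)) ^ (1 / (2 : ℝ)) := hCS
    _ = (∫⁻ s in Ioo 0 t₀, D s ^ θ) ^ (1 / (2 : ℝ)) *
          (∫⁻ s in Ioo 0 t₀, (N s ^ ρ) ^ (1 - θ)) ^ (1 / (2 : ℝ)) := by rw [hDθ, hN2]
    _ ≤ (ENNReal.ofReal t₀ ^ (1 - θ) * (∫⁻ s in Ioo 0 t₀, D s) ^ θ) ^ (1 / (2 : ℝ)) *
          (ENNReal.ofReal t₀ ^ θ * (∫⁻ s in Ioo 0 t₀, N s ^ ρ) ^ (1 - θ)) ^ (1 / (2 : ℝ)) := by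
        gcongr
    _ = ENNReal.ofReal t₀ ^ (1 / 2 : ℝ) * ((∫⁻ s in Ioo 0 t₀, D s) ^ (θ / 2) *
          (∫⁻ s in Ioo 0 t₀, N s ^ ρ) ^ ((1 - θ) / 2)) := by
        rw [ENNReal.mul_rpow_of_nonneg _ _ (by norm_num : (0 : ℝ) ≤ 1 / 2),
          ENNReal.mul_rpow_of_nonneg _ _ (by norm_num : (0 : ℝ) ≤ 1 / 2),
          ← ENNReal.rpow_mul, ← ENNReal.rpow_mul, ← ENNReal.rpow_mul, ← ENNReal.rpow_mul]
        have e : ENNReal.ofReal t₀ ^ ((1 - θ) * (1 / 2)) * ENNReal.ofReal t₀ ^ (θ * (1 / 2)) =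
            ENNReal.ofReal t₀ ^ (1 / 2 : ℝ) := by
          rw [← ENNReal.rpow_add_of_nonneg _ _ (by positivity) (by positivity)]
          congr 1; ring
        rw [show θ * (1 / 2) = θ / 2 by ring, show (1 - θ) * (1 / 2) = (1 - θ) / 2 by ring] at e ⊢
        calc ENNReal.ofReal t₀ ^ ((1 - θ) / 2) * (∫⁻ s in Ioo 0 t₀, D s) ^ (θ / 2) *
              (ENNReal.ofReal t₀ ^ (θ / 2) * (∫⁻ s in Ioo 0 t₀, N s ^ ρ) ^ ((1 - θ) / 2))
            = ENNReal.ofReal t₀ ^ ((1 - θ) / 2) * ENNReal.ofReal t₀ ^ (θ / 2) *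
                ((∫⁻ s in Ioo 0 t₀, D s) ^ (θ / 2) *
                  (∫⁻ s in Ioo 0 t₀, N s ^ ρ) ^ ((1 - θ) / 2)) := by ring
          _ = _ := by rw [e]

/-- `∫₀^{t₀} D^{1/2} ≤ t₀^{1/2} (∫₀^{t₀} D)^{1/2}` (Cauchy–Schwarz / Jensen in time). [folklore] -/
theorem setLIntegral_rpow_half_le {D : ℝ → ℝ≥0∞} {t₀ : ℝ}
    (hD : AEMeasurable D (volume.restrict (Ioo 0 t₀))) :
    ∫⁻ s in Ioo 0 t₀, D s ^ (1 / 2 : ℝ) ≤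
      ENNReal.ofReal t₀ ^ (1 / 2 : ℝ) * (∫⁻ s in Ioo 0 t₀, D s) ^ (1 / 2 : ℝ) := by
  have h := setLIntegral_Ioo_rpow_le hD (by norm_num : (0 : ℝ) ≤ 1 / 2) (by norm_num : (1 : ℝ) / 2 ≤ 1)
  norm_num at h
  simpa only [one_div] using h

end SliceEstimates

/-! ### Vanishing of Serrin-class solutions with null datum functional -/

section Vanishing

variable {T ν : ℝ} {u₀ : E → E} {u : ℝ → E → E}

/-- **A Serrin-class Leray–Hopf solution whose datum functional vanishes is identically zero.**
Let `dim E = 3`, `ν ≥ 0`, `T > 0`, and let `u` be a Leray–Hopf weak solution of the unforced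
system on `E × [0,T)` with datum `u₀` such that `∫ ⟪u₀, w⟫ = 0` for every `w ∈ L²` (the
degenerate branch of `IsLerayHopfOn.aestronglyMeasurable_datum_or`), lying in a Serrin class
`L^q(0,T;L^r)`, `3 < r`, `2/q + 3/r ≤ 1`. Then `E(u(t)) = 0` for every `t ∈ (0, T]`.
Proof: at a good time `t₀` test with `Ψ = u(t₀)` (`inner_weakGrad_test_eq'`, datum term `0`):
`‖u(t₀)‖₂² = ∫₀^{t₀} (∫⟪∇u(t₀) u, u⟫ - ν⟨∇u, ∇u(t₀)⟩)`; the slice bound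
`enorm_weakFlux_le_of_hasWeakGradient`, the uniform bound `‖u(s)‖₂ ≤ (2E(u₀))^{1/2}` and
Cauchy–Schwarz/Jensen in time (`setLIntegral_rpow_mul_le`) give
`2E(u(t₀)) ≤ (t₀ ‖∇u(t₀)‖₂²)^{1/2} (C₁ ε(t₀)^{θ/2} α(t₀)^{(1-θ)/2} + C₂ ε(t₀)^{1/2})` with
`ε(t) = ∫₀ᵗ‖∇u‖₂² → 0`, `α(t) = ∫₀ᵗ‖u‖_r^{2/(1-θ)} → 0`; good times `t₀ ∈ (0, η)` with
`‖∇u(t₀)‖₂² ≤ η⁻¹` exist as soon as `ε(η) < 1`, and the energy is non-increasing from a.e. time,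
so `2E(u(t)) ≤ C₁ α(η)^{(1-θ)/2} + C₂ ε(η)^{1/2} → 0`. (Not in the sources, which assume
`u₀ ∈ L²`; elementary glue making the accepted all-data statement `weak_strong_uniqueness`
true.) [folklore] -/
theorem IsLerayHopfOn.kineticEnergy_eq_zero_of_datum_functional_eq_zero (hE3 : finrank ℝ E = 3)
    (hu : IsLerayHopfOn T ν 0 u₀ u) (hν : 0 ≤ ν) (hT : 0 < T)
    (h0 : ∀ w : E → E, MemLp w 2 volume → ∫ x, ⟪u₀ x, w x⟫ = 0)
    {q r : ℝ≥0∞} (hr : 3 < r) (hqr : 2 / q + 3 / r ≤ 1) (hS : MemLqLp q r u (Ioo 0 T))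
    {t : ℝ} (ht : t ∈ Ioc 0 T) : VectorCalculus.kineticEnergy (u t) = 0 := by
  -- ### exponents and constants
  obtain ⟨hθ0, hθ1, hρq⟩ := serrin_exponent_props hr hqr
  set θ : ℝ := ((3 : ℝ≥0∞) / r).toReal with hθ
  set ρ : ℝ := 2 / (1 - θ) with hρ
  have hρ0 : 0 < ρ := div_pos two_pos (by linarith)
  set Cs : ℝ≥0∞ := (SNormLESNormFDerivOfEqConst E (volume : Measure E) 2 : ℝ≥0∞) with hCs
  set M : ℝ≥0∞ := ENNReal.ofReal (2 * VectorCalculus.kineticEnergy u₀) ^ (1 / 2 : ℝ) with hM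
  have hMtop : M ≠ ⊤ := ENNReal.rpow_ne_top_of_nonneg (by norm_num) ENNReal.ofReal_ne_top
  set C₁ : ℝ≥0∞ := M ^ (1 - θ) * Cs ^ θ with hC₁
  set C₂ : ℝ≥0∞ := ENNReal.ofReal |ν| * (finrank ℝ E : ℝ≥0∞) with hC₂
  have hC₁top : C₁ ≠ ⊤ :=
    ENNReal.mul_ne_top (ENNReal.rpow_ne_top_of_nonneg (by linarith) hMtop)
      (ENNReal.rpow_ne_top_of_nonneg hθ0 ENNReal.coe_ne_top)
  have hC₂top : C₂ ≠ ⊤ := ENNReal.mul_ne_top ENNReal.ofReal_ne_top (ENNReal.natCast_ne_top _)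
  -- ### the weak-gradient witness, made jointly measurable
  obtain ⟨G, hG, hG₂, hE0', hEae'⟩ := hu.weakGrad_energy
  obtain ⟨Gm, hGmm, hGmae⟩ := exists_stronglyMeasurable_weakGradient hu.weak.1 hG
  have hGm : ∀ᵐ s ∂(volume.restrict (Ioo 0 T)), HasWeakGradient (u s) (Gm s) := by
    filter_upwards [hG, hGmae] with s h1 h2
    exact h1.congr_grad_ae h2
  set D : ℝ → ℝ≥0∞ := fun s => ∫⁻ x, ENNReal.ofReal (frobeniusNormSq (Gm s x)) with hD
  have hDm : Measurable D := measurable_lintegral_frobeniusNormSq hGmm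
  have hDG : ∀ᵐ s ∂(volume.restrict (Ioo 0 T)),
      D s = ∫⁻ x, ENNReal.ofReal (frobeniusNormSq (G s x)) := by
    filter_upwards [hGmae] with s hs
    exact lintegral_congr_ae (hs.mono fun x hx => by simp only [hx])
  have hDT : ∫⁻ s in Ioo 0 T, D s < ⊤ := by rw [lintegral_congr_ae hDG]; exact hG₂
  have hDfin : ∀ᵐ s ∂(volume.restrict (Ioo 0 T)), D s < ⊤ := ae_lt_top hDm hDT.ne
  -- ### energy: uniform `L²` bound and monotonicity from a.e. time
  have hE0 : ∀ s ∈ Icc 0 T, VectorCalculus.kineticEnergy (u s) +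
      ν * (∫⁻ τ in Ioo 0 s, ∫⁻ x, ENNReal.ofReal (frobeniusNormSq (G τ x))).toReal ≤
        VectorCalculus.kineticEnergy u₀ := fun s hs => by simpa using hE0' s hs
  have hM2 : ∀ s ∈ Icc 0 T, eLpNorm (u s) 2 volume ≤ M := fun s hs => hu.eLpNorm_two_le hν hE0 hs
  have hmono : ∀ᵐ s ∂(volume.restrict (Ioo 0 T)), ∀ τ ∈ Icc s T,
      VectorCalculus.kineticEnergy (u τ) ≤ VectorCalculus.kineticEnergy (u s) := by
    filter_upwards [hEae'] with s hs τ hτ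
    have h := hs τ hτ
    simp only [Pi.zero_apply, inner_zero_left, integral_zero, intervalIntegral.integral_zero,
      add_zero] at h
    have hnn : 0 ≤ ν * (∫⁻ τ' in Ioo s τ, ∫⁻ x,
        ENNReal.ofReal (frobeniusNormSq (G τ' x))).toReal := mul_nonneg hν ENNReal.toReal_nonneg
    linarith
  -- ### the Serrin norm and the two small quantities
  set N : ℝ → ℝ≥0∞ := fun s => eLpNorm (u s) r volume with hN
  have hNm : AEMeasurable N (volume.restrict (Ioo 0 T)) :=
    FunctionSpaces.aemeasurable_eLpNorm_slice hu.aestronglyMeasurable_uncurry r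
  have hNT : ∫⁻ s in Ioo 0 T, N s ^ ρ < ⊤ := by
    have hvol : volume (Ioo (0 : ℝ) T) ≠ ∞ := by simp
    exact lintegral_rpow_eLpNorm_lt_top hvol hS hρ0.le hρq
  set ε : ℝ → ℝ≥0∞ := fun η => ∫⁻ s in Ioo 0 η, D s with hε
  set α : ℝ → ℝ≥0∞ := fun η => ∫⁻ s in Ioo 0 η, N s ^ ρ with hα
  set β : ℝ → ℝ≥0∞ := fun η => C₁ * α η ^ ((1 - θ) / 2) + C₂ * ε η ^ (1 / 2 : ℝ) with hβ
  -- ### good times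
  have hgood : ∀ᵐ s ∂(volume.restrict (Ioo 0 T)), s ∈ Ioo 0 T ∧ HasWeakGradient (u s) (Gm s) ∧
      D s < ⊤ ∧ IsWeaklyDivFree (u s) ∧
      ∀ τ ∈ Icc s T, VectorCalculus.kineticEnergy (u τ) ≤ VectorCalculus.kineticEnergy (u s) := by
    filter_upwards [ae_restrict_mem measurableSet_Ioo, hGm, hDfin, hu.weak.ae_isWeaklyDivFree,
      hmono] with s h1 h2 h3 h4 h5
    exact ⟨h1, h2, h3, h4, h5⟩
  -- ### the key estimate at a good time `t₀`
  have hkey : ∀ t₀, t₀ ∈ Ioo 0 T → HasWeakGradient (u t₀) (Gm t₀) → D t₀ < ⊤ →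
      IsWeaklyDivFree (u t₀) →
      ENNReal.ofReal (2 * VectorCalculus.kineticEnergy (u t₀)) ≤
        (D t₀ * ENNReal.ofReal t₀) ^ (1 / 2 : ℝ) *
          (C₁ * (ε t₀ ^ (θ / 2) * α t₀ ^ ((1 - θ) / 2)) + C₂ * ε t₀ ^ (1 / 2 : ℝ)) := by
    intro t₀ ht₀ hGt₀ hDt₀ hdiv₀
    have ht₀' : t₀ ∈ Ioc 0 T := ⟨ht₀.1, ht₀.2.le⟩
    have hmem₀ : MemLp (u t₀) 2 volume := hu.memLp t₀ ⟨ht₀.1.le, ht₀.2.le⟩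
    have hA : AEStronglyMeasurable (Gm t₀) volume :=
      (hGmm.of_uncurry_left (x := t₀)).aestronglyMeasurable
    -- the slice identity with `Ψ = u t₀`; the datum term vanishes
    have hid := hu.inner_weakGrad_test_eq' hE3 hT hGmm hGm hDT hmem₀ hdiv₀ hGt₀ hDt₀ ht₀'
    rw [h0 _ hmem₀, zero_add] at hid
    set F : ℝ → ℝ := fun s => (∫ x, ⟪Gm t₀ x (u s x), u s x⟫) -
      ν * ∑ i, ∫ x, ⟪Gm s x (stdOrthonormalBasis ℝ E i), Gm t₀ x (stdOrthonormalBasis ℝ E i)⟫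
      with hF
    -- `2 E(u t₀) = ∫ F ≤ ∫ |F|`
    have hKE : 2 * VectorCalculus.kineticEnergy (u t₀) = ∫ s in Ioc 0 t₀, F s := by
      rw [← hid, VectorCalculus.kineticEnergy, ← mul_assoc, mul_inv_cancel₀ two_ne_zero, one_mul]
      exact integral_congr_ae (ae_of_all _ fun x => (real_inner_self_eq_norm_sq (u t₀ x)).symm)
    have hlhs : ENNReal.ofReal (2 * VectorCalculus.kineticEnergy (u t₀)) ≤
        ∫⁻ s in Ioo 0 t₀, ‖F s‖ₑ := by
      rw [hKE]
      calc ENNReal.ofReal (∫ s in Ioc 0 t₀, F s) ≤ ‖∫ s in Ioc 0 t₀, F s‖ₑ :=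
            Real.ofReal_le_enorm _
        _ ≤ ∫⁻ s in Ioc 0 t₀, ‖F s‖ₑ := enorm_integral_le_lintegral_enorm _
        _ = ∫⁻ s in Ioo 0 t₀, ‖F s‖ₑ := setLIntegral_congr Ioo_ae_eq_Ioc.symm
    -- pointwise bound of `|F s|` for a.e. `s ∈ (0, t₀)`
    have hsub : Ioo 0 t₀ ⊆ Ioo 0 T := Ioo_subset_Ioo le_rfl ht₀.2.le
    have hpt : ∀ᵐ s ∂(volume.restrict (Ioo 0 t₀)), ‖F s‖ₑ ≤
        D t₀ ^ (1 / 2 : ℝ) * (C₁ * (D s ^ (θ / 2) * N s) + C₂ * D s ^ (1 / 2 : ℝ)) := by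
      filter_upwards [ae_restrict_of_ae_restrict_of_subset hsub hgood] with s hs
      obtain ⟨hsI, hGs, -, -, -⟩ := hs
      have hmem2 : MemLp (u s) 2 volume := hu.memLp s (Ioo_subset_Icc_self hsI)
      refine (enorm_weakFlux_le_of_hasWeakGradient hE3 hr hmem2 hGs hA ν).trans ?_
      have hMs : eLpNorm (u s) 2 volume ^ (1 - θ) ≤ M ^ (1 - θ) :=
        ENNReal.rpow_le_rpow (hM2 s (Ioo_subset_Icc_self hsI)) (by linarith)
      calc D t₀ ^ (1 / 2 : ℝ) *
            (eLpNorm (u s) 2 volume ^ (1 - θ) * (Cs * D s ^ (1 / 2 : ℝ)) ^ θ * N s +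
              ENNReal.ofReal |ν| * (finrank ℝ E : ℝ≥0∞) * D s ^ (1 / 2 : ℝ))
          ≤ D t₀ ^ (1 / 2 : ℝ) *
            (M ^ (1 - θ) * (Cs * D s ^ (1 / 2 : ℝ)) ^ θ * N s +
              ENNReal.ofReal |ν| * (finrank ℝ E : ℝ≥0∞) * D s ^ (1 / 2 : ℝ)) := by gcongr
        _ = D t₀ ^ (1 / 2 : ℝ) * (C₁ * (D s ^ (θ / 2) * N s) + C₂ * D s ^ (1 / 2 : ℝ)) := by
            have e : (Cs * D s ^ (1 / 2 : ℝ)) ^ θ = Cs ^ θ * D s ^ (θ / 2) := by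
              rw [ENNReal.mul_rpow_of_nonneg _ _ hθ0, ← ENNReal.rpow_mul,
                show (1 / 2 : ℝ) * θ = θ / 2 by ring]
            rw [e, hC₁, hC₂]
            ring
    -- integrate in time
    have hDm₀ : AEMeasurable D (volume.restrict (Ioo 0 t₀)) := hDm.aemeasurable
    have hNm₀ : AEMeasurable N (volume.restrict (Ioo 0 t₀)) :=
      hNm.mono_measure (Measure.restrict_mono hsub le_rfl)
    have hm1 : AEMeasurable (fun s => D s ^ (θ / 2) * N s) (volume.restrict (Ioo 0 t₀)) :=
      (hDm₀.pow_const _).mul hNm₀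
    have hm2 : AEMeasurable (fun s => D s ^ (1 / 2 : ℝ)) (volume.restrict (Ioo 0 t₀)) :=
      hDm₀.pow_const _
    have hint : ∫⁻ s in Ioo 0 t₀, ‖F s‖ₑ ≤ D t₀ ^ (1 / 2 : ℝ) *
        (C₁ * (ENNReal.ofReal t₀ ^ (1 / 2 : ℝ) * (ε t₀ ^ (θ / 2) * α t₀ ^ ((1 - θ) / 2))) +
          C₂ * (ENNReal.ofReal t₀ ^ (1 / 2 : ℝ) * ε t₀ ^ (1 / 2 : ℝ))) := by
      calc ∫⁻ s in Ioo 0 t₀, ‖F s‖ₑ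
          ≤ ∫⁻ s in Ioo 0 t₀, D t₀ ^ (1 / 2 : ℝ) *
              (C₁ * (D s ^ (θ / 2) * N s) + C₂ * D s ^ (1 / 2 : ℝ)) := lintegral_mono_ae hpt
        _ = D t₀ ^ (1 / 2 : ℝ) * (C₁ * (∫⁻ s in Ioo 0 t₀, D s ^ (θ / 2) * N s) +
              C₂ * (∫⁻ s in Ioo 0 t₀, D s ^ (1 / 2 : ℝ))) := by
            have hm3 : AEMeasurable
                (fun s => C₁ * (D s ^ (θ / 2) * N s) + C₂ * D s ^ (1 / 2 : ℝ))
                (volume.restrict (Ioo 0 t₀)) := (hm1.const_mul C₁).add (hm2.const_mul C₂)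
            rw [lintegral_const_mul'' _ hm3, lintegral_add_left' (hm1.const_mul C₁),
              lintegral_const_mul'' _ hm1, lintegral_const_mul'' _ hm2]
        _ ≤ _ := by
            gcongr
            · exact setLIntegral_rpow_mul_le hDm₀ hNm₀ hθ0 hθ1
            · exact setLIntegral_rpow_half_le hDm₀
    calc ENNReal.ofReal (2 * VectorCalculus.kineticEnergy (u t₀))
        ≤ ∫⁻ s in Ioo 0 t₀, ‖F s‖ₑ := hlhs
      _ ≤ _ := hint
      _ = (D t₀ * ENNReal.ofReal t₀) ^ (1 / 2 : ℝ) *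
          (C₁ * (ε t₀ ^ (θ / 2) * α t₀ ^ ((1 - θ) / 2)) + C₂ * ε t₀ ^ (1 / 2 : ℝ)) := by
          rw [ENNReal.mul_rpow_of_nonneg _ _ (by norm_num : (0 : ℝ) ≤ 1 / 2)]
          ring
  -- ### limits `ε, α, β → 0` as `η → 0⁺`
  have hvol : Tendsto (fun η : ℝ => (volume.restrict (Ioo (0 : ℝ) T)) (Ioo 0 η)) (𝓝[>] 0) (𝓝 0) := by
    have h1 : Tendsto (fun η : ℝ => ENNReal.ofReal η) (𝓝[>] 0) (𝓝 0) := by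
      have h := ENNReal.tendsto_ofReal (tendsto_id (x := 𝓝 (0 : ℝ)))
      rw [ENNReal.ofReal_zero] at h
      exact tendsto_nhdsWithin_of_tendsto_nhds h
    refine tendsto_of_tendsto_of_tendsto_of_le_of_le tendsto_const_nhds h1 (fun _ => zero_le)
      fun η => ?_
    calc (volume.restrict (Ioo (0 : ℝ) T)) (Ioo 0 η) ≤ volume (Ioo (0 : ℝ) η) :=
          Measure.restrict_apply_le _ _
      _ = ENNReal.ofReal η := by rw [Real.volume_Ioo, sub_zero]
  have hεlim : Tendsto ε (𝓝[>] 0) (𝓝 0) := by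
    have h := tendsto_setLIntegral_zero (μ := volume.restrict (Ioo 0 T)) (f := D) hDT.ne hvol
    refine h.congr' ?_
    filter_upwards [Ioo_mem_nhdsGT hT] with η hη
    change ∫⁻ s in Ioo 0 η, D s ∂(volume.restrict (Ioo 0 T)) = ∫⁻ s in Ioo 0 η, D s
    rw [Measure.restrict_restrict measurableSet_Ioo,
      inter_eq_left.2 (Ioo_subset_Ioo le_rfl hη.2.le)]
  have hαlim : Tendsto α (𝓝[>] 0) (𝓝 0) := by
    have h := tendsto_setLIntegral_zero (μ := volume.restrict (Ioo 0 T)) (f := fun s => N s ^ ρ)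
      hNT.ne hvol
    refine h.congr' ?_
    filter_upwards [Ioo_mem_nhdsGT hT] with η hη
    change ∫⁻ s in Ioo 0 η, N s ^ ρ ∂(volume.restrict (Ioo 0 T)) = ∫⁻ s in Ioo 0 η, N s ^ ρ
    rw [Measure.restrict_restrict measurableSet_Ioo,
      inter_eq_left.2 (Ioo_subset_Ioo le_rfl hη.2.le)]
  have hβlim : Tendsto β (𝓝[>] 0) (𝓝 0) := by
    have h1 : Tendsto (fun η => α η ^ ((1 - θ) / 2)) (𝓝[>] 0) (𝓝 0) := by
      have h := ((ENNReal.continuous_rpow_const (y := (1 - θ) / 2)).tendsto 0).comp hαlim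
      rwa [ENNReal.zero_rpow_of_pos (by linarith : 0 < (1 - θ) / 2)] at h
    have h2 : Tendsto (fun η => ε η ^ (1 / 2 : ℝ)) (𝓝[>] 0) (𝓝 0) := by
      have h := ((ENNReal.continuous_rpow_const (y := (1 / 2 : ℝ))).tendsto 0).comp hεlim
      rwa [ENNReal.zero_rpow_of_pos (by norm_num : 0 < (1 / 2 : ℝ))] at h
    have h := (ENNReal.Tendsto.const_mul h1 (Or.inr hC₁top)).add
      (ENNReal.Tendsto.const_mul h2 (Or.inr hC₂top))
    simpa only [mul_zero, add_zero] using h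
  -- ### for small `η`, a good time `t₀ ∈ (0, η)` with `D t₀ ≤ η⁻¹`
  have hsel : ∀ η, 0 < η → η ≤ T → ε η < 1 →
      ∃ t₀ ∈ Ioo 0 η, (t₀ ∈ Ioo 0 T ∧ HasWeakGradient (u t₀) (Gm t₀) ∧ D t₀ < ⊤ ∧
        IsWeaklyDivFree (u t₀) ∧
        ∀ τ ∈ Icc t₀ T, VectorCalculus.kineticEnergy (u τ) ≤ VectorCalculus.kineticEnergy (u t₀)) ∧
        D t₀ ≤ (ENNReal.ofReal η)⁻¹ := by
    intro η hη hηT hεη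
    by_contra hne
    push Not at hne
    have hsubη : Ioo 0 η ⊆ Ioo 0 T := Ioo_subset_Ioo le_rfl hηT
    have hae : ∀ᵐ s ∂(volume.restrict (Ioo 0 η)), (ENNReal.ofReal η)⁻¹ ≤ D s := by
      filter_upwards [ae_restrict_mem measurableSet_Ioo,
        ae_restrict_of_ae_restrict_of_subset hsubη hgood] with s hs hg
      exact (hne s hs hg).le
    have h1 : (1 : ℝ≥0∞) ≤ ε η := by
      calc (1 : ℝ≥0∞) = (ENNReal.ofReal η)⁻¹ * volume (Ioo (0 : ℝ) η) := by
            rw [Real.volume_Ioo, sub_zero,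
              ENNReal.inv_mul_cancel (ENNReal.ofReal_pos.2 hη).ne' ENNReal.ofReal_ne_top]
        _ = ∫⁻ _ in Ioo (0 : ℝ) η, (ENNReal.ofReal η)⁻¹ := (setLIntegral_const _ _).symm
        _ ≤ ε η := lintegral_mono_ae hae
    exact absurd hεη (not_lt.2 h1)
  -- ### conclusion at the fixed time `t`
  have hev : ∀ᶠ η in 𝓝[>] (0 : ℝ), ENNReal.ofReal (2 * VectorCalculus.kineticEnergy (u t)) ≤ β η := by
    have h2 : ∀ᶠ η in 𝓝[>] (0 : ℝ), ε η < 1 := hεlim (Iio_mem_nhds one_pos)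
    filter_upwards [Ioo_mem_nhdsGT ht.1, h2] with η hη hεη
    have hηT : η ≤ T := hη.2.le.trans ht.2
    obtain ⟨t₀, ht₀η, ⟨ht₀T, hGt₀, hDt₀, hdiv₀, hmono₀⟩, hDle⟩ := hsel η hη.1 hηT hεη
    have hk := hkey t₀ ht₀T hGt₀ hDt₀ hdiv₀
    have hEt : VectorCalculus.kineticEnergy (u t) ≤ VectorCalculus.kineticEnergy (u t₀) :=
      hmono₀ t ⟨(ht₀η.2.trans hη.2).le, ht.2⟩
    have hone : (D t₀ * ENNReal.ofReal t₀) ^ (1 / 2 : ℝ) ≤ 1 := by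
      refine ENNReal.rpow_le_one ?_ (by norm_num)
      calc D t₀ * ENNReal.ofReal t₀ ≤ (ENNReal.ofReal η)⁻¹ * ENNReal.ofReal η :=
            mul_le_mul' hDle (ENNReal.ofReal_le_ofReal ht₀η.2.le)
        _ = 1 := ENNReal.inv_mul_cancel (ENNReal.ofReal_pos.2 hη.1).ne' ENNReal.ofReal_ne_top
    have hsub₀ : Ioo 0 t₀ ⊆ Ioo 0 η := Ioo_subset_Ioo le_rfl ht₀η.2.le
    have hε₀ : ε t₀ ≤ ε η := lintegral_mono_set hsub₀
    have hα₀ : α t₀ ≤ α η := lintegral_mono_set hsub₀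
    have hεθ : ε t₀ ^ (θ / 2) ≤ 1 := ENNReal.rpow_le_one (hε₀.trans hεη.le) (by positivity)
    calc ENNReal.ofReal (2 * VectorCalculus.kineticEnergy (u t))
        ≤ ENNReal.ofReal (2 * VectorCalculus.kineticEnergy (u t₀)) :=
          ENNReal.ofReal_le_ofReal (by linarith)
      _ ≤ (D t₀ * ENNReal.ofReal t₀) ^ (1 / 2 : ℝ) *
          (C₁ * (ε t₀ ^ (θ / 2) * α t₀ ^ ((1 - θ) / 2)) + C₂ * ε t₀ ^ (1 / 2 : ℝ)) := hk
      _ ≤ 1 * (C₁ * (1 * α η ^ ((1 - θ) / 2)) + C₂ * ε η ^ (1 / 2 : ℝ)) := by gcongr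
      _ = β η := by rw [one_mul, one_mul]
  have hle : ENNReal.ofReal (2 * VectorCalculus.kineticEnergy (u t)) ≤ 0 :=
    le_of_tendsto_of_tendsto tendsto_const_nhds hβlim hev
  have h2 : 2 * VectorCalculus.kineticEnergy (u t) ≤ 0 :=
    ENNReal.ofReal_eq_zero.1 (le_zero_iff.1 hle)
  exact le_antisymm (by linarith) (kineticEnergy_nonneg _)

end Vanishing

/-! ### The discharge -/

/-- **ns.S07, weak–strong uniqueness in the Ladyzhenskaya–Prodi–Serrin class — discharge of the
accepted named fact `weak_strong_uniqueness` for all data `u₀ : ℝ³ → ℝ³`** (Prodi 1959;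
Serrin 1963, Thm. 6; Robinson–Rodrigo–Sadowski 2016, Thm. 8.19). Let `ν > 0`, `u` a Leray–Hopf
weak solution of the unforced system on `ℝ³ × [0,T)` with datum `u₀` and `u ∈ L^q(0,T;L^r)`,
`2/q + 3/r ≤ 1`, `3 < r ≤ ∞`; then every Leray–Hopf weak solution `v` on `[0,T)` with the same
viscosity and datum satisfies `v(t) = u(t)` a.e. for every `t ∈ (0,T]`.
Proof: by `IsLerayHopfOn.aestronglyMeasurable_datum_or`, either `u₀` is a.e. strongly measurable
— the printed theorem, `weak_strong_uniqueness_of_datum` / `serrin_weak_strong_uniqueness_holds` —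
or the datum functional vanishes on `L²`; then, if `‖u₀‖²` is not integrable,
`weak_strong_uniqueness_of_datum` again (`kineticEnergy u₀ = 0`), and otherwise the Serrin-class
solution vanishes on `(0,T]` (`IsLerayHopfOn.kineticEnergy_eq_zero_of_datum_functional_eq_zero`),
so the strong attainment `eLpNorm (u t - u₀) 2 → 0` gives `∫⁻ ‖u₀‖ₑ² = 0`, `u₀ = 0` a.e., and
`u₀` is a.e. strongly measurable after all. [cite: Prodi1959] -/
theorem weak_strong_uniqueness_holds : weak_strong_uniqueness := by
  intro ν T hν hT u₀ u v hu q r hr hqr hS hv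
  rcases hu.aestronglyMeasurable_datum_or hT with hm | h0
  · exact weak_strong_uniqueness_of_datum hν hT hu (Or.inl hm) hr hqr hS hv
  by_cases hint : Integrable (fun x => ‖u₀ x‖ ^ 2) volume
  swap
  · exact weak_strong_uniqueness_of_datum hν hT hu (Or.inr hint) hr hqr hS hv
  -- degenerate branch with `‖u₀‖²` integrable: `u ≡ 0` on `(0,T]`, hence `u₀ = 0` a.e.
  have hE3 : finrank ℝ (EuclideanSpace ℝ (Fin 3)) = 3 := finrank_euclideanSpace_fin
  have hzero : ∀ t ∈ Ioc 0 T, u t =ᵐ[volume] 0 := by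
    intro t ht
    have hK := hu.kineticEnergy_eq_zero_of_datum_functional_eq_zero hE3 hν.le hT h0 hr hqr hS ht
    have hut : MemLp (u t) 2 volume := hu.memLp t ⟨ht.1.le, ht.2⟩
    have hint0 : ∫ x, ‖u t x‖ ^ 2 = 0 := by
      rw [VectorCalculus.kineticEnergy] at hK
      simpa using hK
    have hsq : (fun x => ‖u t x‖ ^ 2) =ᵐ[volume] 0 :=
      (integral_eq_zero_iff_of_nonneg (fun x => sq_nonneg _)
        ((memLp_two_iff_integrable_sq_norm hut.1).1 hut)).1 hint0
    filter_upwards [hsq] with x hx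
    simpa using hx
  -- `∫⁻ ‖u₀‖ₑ² = 0` by the strong attainment of the datum
  have hlin : ∫⁻ x, ‖u₀ x‖ₑ ^ 2 = 0 := by
    have h1 : Tendsto (fun t => eLpNorm (u t - u₀) 2 volume ^ 2) (𝓝[>] (0 : ℝ)) (𝓝 0) := by
      have h := ((ENNReal.continuous_pow 2).tendsto (0 : ℝ≥0∞)).comp hu.strong_initial
      simp only [ne_eq, OfNat.ofNat_ne_zero, not_false_eq_true, zero_pow] at h
      exact h
    have h2 : ∀ᶠ t in 𝓝[>] (0 : ℝ), eLpNorm (u t - u₀) 2 volume ^ 2 = ∫⁻ x, ‖u₀ x‖ₑ ^ 2 := by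
      filter_upwards [Ioo_mem_nhdsGT hT] with t ht
      rw [← eEnergy_eq_eLpNorm_sq, eEnergy]
      refine lintegral_congr_ae ?_
      filter_upwards [hzero t ⟨ht.1, ht.2.le⟩] with x hx
      simp [hx]
    exact tendsto_nhds_unique tendsto_const_nhds (h1.congr' h2)
  have hmeas : AEMeasurable (fun x => ‖u₀ x‖ₑ ^ 2) volume := by
    refine hint.aestronglyMeasurable.aemeasurable.ennreal_ofReal.congr (ae_of_all _ fun x => ?_)
    simp only
    rw [ENNReal.ofReal_pow (norm_nonneg _), ofReal_norm]
  have hu₀ae : u₀ =ᵐ[volume] 0 := by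
    filter_upwards [(lintegral_eq_zero_iff' hmeas).1 hlin] with x hx
    simpa using hx
  have hm : AEStronglyMeasurable u₀ volume :=
    (aestronglyMeasurable_const (b := (0 : EuclideanSpace ℝ (Fin 3)))).congr hu₀ae.symm
  exact weak_strong_uniqueness_of_datum hν hT hu (Or.inl hm) hr hqr hS hv

end Literature.Analysis.FluidPDE
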